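import Summits.BirchSwinnertonDyer.BirchSwinnertonDyer.Theorems.EisensteinPrimesSplitMultIndexInputs
import Summits.BirchSwinnertonDyer.BirchSwinnertonDyer.Theorems.EisensteinPrimesSplitMultIndexPlumbing
import Summits.BirchSwinnertonDyer.BirchSwinnertonDyer.Theorems.EisensteinPrimesAnticyclotomicLocalCdOne
import HarnessLib

/-!
# Crux 4 `BSDpOnCellC` (stmt-BirchSwinnertonDyer-19034), line b1 — the SPLIT conjunct of the wall `stub_imprimitiveCount`:
# **KELLER–YIN'S ANOMALOUS λ-INEQUALITY (Thm. 1.4.1 (iii), `≤` half, Cases I–III) AT A SPLIT MULTIPLICATIVE EISENSTEIN PRIME**,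
# `λ(𝔛^{Sf}_nr(θsub)) + λ(𝔛^{Sf}_nr(θquot)) ≤ λ(𝔛^{Sf}_f) + [θquot|_{G_K} = 𝟙]`, in the kernel modulo the Greenberg facts and
# `cd_p(G_{K,Σ}) ≤ 2` BY NAME — the x1 cell's V21 index road run at the split datum, orientation (ω, 𝟙)

Cell `bsd-eis` (run/shared/lean/pub/bsd-eis/), width seat `bsd-line-x2-p2` gen 10 (`--supports -19034`, closes nothing; skeleton of
record b1 v12 sha256 155e218d… UNCHANGED, W-79). Assembles p672062 (`…SplitMultLocalHZero`), `…SplitMultIndexPlumbing`,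
`…SplitMultIndexInputs` with the x1 cell's LANDED mid-level composition `ResidualIndexAssembly.zpCorank_datumStrictSelmer_add_eq` (LEAD x1-p1 g4,
p645893) and local `cd_p ≤ 1` package `AnticyclotomicLocalCdOne` (x1-p1-w4 g3) — the glue `imprimLambdaLE_of_index` of
`Cruxes/GoodLatticeBDPValue/Lines/halves.lean` (v20.3–v25) transported from the good anomalous lattice to a SPLIT multiplicative prime.

STATEMENT `lambdaInvariant_add_le_of_split`. `W/ℚ` globally minimal, `2 < p` a SPLIT multiplicative prime, `K` imaginary quadratic
with (Heeg) for `N_W` and `(p)` split, `E(K)[p] = 0`, `v` through `ι : K →+* ℚ_p`, `v̄ ∋ p`, `v̄ ≠ v`, `κ` anticyclotomic with topological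
generator `γ`, `(θsub, θquot)` a residual pair of `E_K[p]` with `θsub` RAMIFIED at `v̄` (some `τ ∈ I_v̄`, `θsub(τ) ≠ 1`: the residual line is the
Tate line — orientation (ω, 𝟙)), `Sf` a finite set of places with `w ∈ Sf ↔ N_W ∈ w` (x1's convention; at `p ∣ N` it contains the places
over `p`, read by no Selmer condition of the road), dual data `DSsub`, `DSquot` of `H¹_{𝓕_nr^{Sf}}(K_∞, (F/𝒪)(θ))`, the cotorsion clauses
(`𝔛^{Sf}_f` f.g. `Λ`-torsion `μ = 0` — on line b1: Keller–Yin Lemma 5.1.1 = `stub_lemma511`; `∀ D` f.g. torsion `μ = 0` for both characters —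
on line b1: the [BR]-type inputs), GRANTED Greenberg 2016 Prop. 2.6.3, Greenberg 2006 Props. 4.1, 4.2, §5 A, 3.2 and `cd_p(G_{K,Σ}) ≤ 2`
BY NAME: `λ(DSsub.X) + λ(DSquot.X) ≤ λ(𝔛^{Sf}_f) + [θquot = 𝟙]`.

PROOF = the x1 glue: the ∃-package `SplitMultIndexInputs.indexInputs_split`; DIV ×3 and LRS from `cd_p(ker κ ⊓ D_v̄) ≤ 1`
(`AnticyclotomicLocalCdOne`); the mid-level identity `zpCorank R(E_K[p^∞]) + ε = zpCorank R(θsub) + zpCorank R(θquot) + p^c`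
(`ResidualIndexAssembly.zpCorank_datumStrictSelmer_add_eq`, fed the 35 conjuncts); then `SplitMultIndexPlumbing.lambdaInvariant_add_le_of_mid_split`.

WHAT THIS IS FOR. On line b1 the SPLIT conjunct of the wall reads `m + Σ_{w∈Sf} λ𝒫_w(f) ≤ λ(𝔛^{Sf}_f)`; as in the x1 line and in this
seat's lineage's NON-SPLIT chain (g8/g9: TEN PUB + [BR𝟙] + [BRω-mult] + [AN-mult]), it is this ALGEBRAIC inequality + the two character
main conjectures ([BR𝟙] at the `p`-unramified member `θquot`, anomalous case `θquot|_{G_v̄} = 𝟙` — Keller–Yin's extension of Rubin; the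
functional-equation reading at `θsub`) + ONE analytic sentence at `p ‖ N`. This file is the algebraic inequality; the transfer from `Sf ∪ {v, v̄}`
to line b1's `Sf` (places over `N` off `p`) and the (𝟙, ω) orientation (= (ω, 𝟙) for the isogenous curve `E/Φ`) are later bricks.

HONEST FRAMING: helper theorem only (0 defs, 0 named facts introduced, 0 sorry); CONDITIONAL on the six named published facts it takes as
hypotheses (all already hypotheses of the x1 line and of line b1's chain); closes no stub; no summit statement / BSD / MC / IMC / KY
Thm. 1.4.1 (iii) for any curve is proved here (the cotorsion clauses are hypotheses); 0 cells / labels / tiers move.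

References: [KellerYin2024] Thm. 1.4.1 (iii), §1.3 Cases I–III, §1.4, Lemma 5.1.1, §5.1 (arXiv:2402.12781v2 TeX L1087–1330, L1725–1769);
[GreenbergVatsal2000] §2 pp. 14–15, Prop. (2.4); [Greenberg2016Selmer] Prop. 2.6.3; [Greenberg2006] Props. 3.2, 4.1, 4.2, §5 A;
[NeukirchSchmidtWingberg2008] (8.3.18); [PollackWeston2011] Prop. A.2; the x1 road memo `Cruxes/GoodLatticeBDPValue/Lines/halves-imprimLambda-index-road.md`.
-/

set_option autoImplicit false
-- the route's Theorems namespace repeats the summit name by design (D-0017 nested layout)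
set_option linter.dupNamespace false

noncomputable section

open scoped Classical

namespace Summit.BirchSwinnertonDyer.BirchSwinnertonDyer.Theorems.SplitMultLambdaLE

open PowerSeries WeierstrassCurve NumberField IsDedekindDomain Field
  Literature.NumberTheory.GaloisRepresentations Literature.NumberTheory.EllipticCurves.GreenbergVatsal2000
  Literature.NumberTheory.EllipticCurves Literature.NumberTheory.EllipticCurves.Rank1Residual
  Literature.NumberTheory.EllipticCurves.Castella2018 Literature.NumberTheory.EllipticCurves.GreenbergSelmer
  Literature.NumberTheory.QuadraticFields Literature.NumberTheory.EllipticCurves.KellerYin2024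
  Literature.NumberTheory.EllipticCurves.IwasawaAlgebra Literature.NumberTheory.IwasawaTheory
  Literature.NumberTheory.IwasawaTheory.Greenberg2016 Literature.NumberTheory.IwasawaTheory.Greenberg2006
  Literature.NumberTheory.GaloisCohomology
  Summit.BirchSwinnertonDyer.Rank1Residual.X2.ResidualDevissageModules
  Summit.BirchSwinnertonDyer.BirchSwinnertonDyer.Theorems

/-- **Keller–Yin's anomalous `λ`-inequality (Thm. 1.4.1 (iii), `≤` half) AT A SPLIT MULTIPLICATIVE EISENSTEIN PRIME, orientation (ω, 𝟙), in
the kernel modulo the Greenberg facts and `cd_p(G_{K,Σ}) ≤ 2` BY NAME**: see the module docstring for the binders; conclusion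
`λ(DSsub.X) + λ(DSquot.X) ≤ λ(𝔛^{Sf}_f) + [θquot = 𝟙]`. The x1 V21 index road (∃-package → `cd_p ≤ 1` local inputs → mid-level
composition → plumbing) run on this seat's split-multiplicative inputs.
[cite: KellerYin2024, Thm. 1.4.1 (iii) and §1.3–§1.4 Cases I–III, §5.1 (arXiv:2402.12781v2 TeX L1087–1330, L1725–1769)]
[cite: GreenbergVatsal2000, §2 pp. 14–15] [cite: Greenberg2016Selmer, Prop. 2.6.3] [cite: Greenberg2006, Props. 3.2, 4.1, 4.2, §5 A]
[cite: NeukirchSchmidtWingberg2008, (8.3.18)] -/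
theorem lambdaInvariant_add_le_of_split (h263 : prop263_sur_of_crk) (h41 : prop41_globalEulerPoincareCorank)
    (h42 : prop42_localEulerPoincareCorank) (h5A : sec5A_localH2_subsingleton_of_LOC1)
    (h32 : prop32_cohomology_isCofinitelyGenerated)
    (W : WeierstrassCurve ℚ) [W.IsElliptic] [W.IsGloballyMinimal] (p : ℕ) [Fact p.Prime]
    (hp : 2 < p) (hsplitred : W.HasSplitMultiplicativeReductionAtPrime p)
    (K : Type) [Field K] [NumberField K] (hK : IsImaginaryQuadratic K)
    (hCD2 : groupCdLE_two_galoisGroupUnramifiedOutside K)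
    (hH : SatisfiesHeegnerHypothesis (W.conductorNorm ℤ) K)
    (hsplit : ((Ideal.span {(p : ℤ)}).primesOver (𝓞 K)).ncard = 2)
    (htor : ∀ Q : (W.baseChange K).toAffine.Point, p • Q = 0 → Q = 0)
    (ι : K →+* ℚ_[p]) (v vbar : HeightOneSpectrum (𝓞 K))
    (hv : ∀ x : 𝓞 K, x ∈ v.asIdeal ↔ ‖ι (x : K)‖ < 1)
    (hvbar : ((p : ℕ) : 𝓞 K) ∈ vbar.asIdeal) (hne : vbar ≠ v)
    (κ : ZpExtension K p) (hκ : κ.IsAnticyclotomic)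
    (γ : absoluteGaloisGroup K) [Fact (κ.IsTopGenerator γ)]
    (θsub θquot : FramedGaloisRep K (padicCoeffIntegers (∅ : Set (PadicAlgCl p))) 1)
    (hpair : IsResidualPairOver (W.baseChange K) p θsub θquot)
    (hramI : ∃ τ ∈ inertia vbar, unitChar θsub τ ≠ 1)
    (Sf : Finset (HeightOneSpectrum (𝓞 K)))
    (hSf : ∀ w : HeightOneSpectrum (𝓞 K), w ∈ Sf ↔ ((W.conductorNorm ℤ : ℤ) : 𝓞 K) ∈ w.asIdeal)
    (DSsub : DatumDualData κ γ (charModule ∅ θsub)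
        (AcSelmer.bdpData (charModule ∅ θsub) p vbar) (↑Sf : Set (HeightOneSpectrum (𝓞 K))))
    (DSquot : DatumDualData κ γ (charModule ∅ θquot)
        (AcSelmer.bdpData (charModule ∅ θquot) p vbar) (↑Sf : Set (HeightOneSpectrum (𝓞 K))))
    (hfgS : Module.Finite (IwasawaAlgebra p) (AcSelmer.XAc (W.baseChange K) p κ vbar (↑Sf : Set (HeightOneSpectrum (𝓞 K))) γ))
    (htorS : Module.IsTorsion (IwasawaAlgebra p) (AcSelmer.XAc (W.baseChange K) p κ vbar (↑Sf : Set (HeightOneSpectrum (𝓞 K))) γ))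
    (hμS : muInvariant p (AcSelmer.XAc (W.baseChange K) p κ vbar (↑Sf : Set (HeightOneSpectrum (𝓞 K))) γ) = 0)
    (hSsub : ∀ D : DatumDualData κ γ (charModule ∅ θsub)
        (AcSelmer.bdpData (charModule ∅ θsub) p vbar) (↑Sf : Set (HeightOneSpectrum (𝓞 K))),
      Module.Finite (IwasawaAlgebra p) D.X ∧ Module.IsTorsion (IwasawaAlgebra p) D.X ∧ muInvariant p D.X = 0)
    (hSquot : ∀ D : DatumDualData κ γ (charModule ∅ θquot)
        (AcSelmer.bdpData (charModule ∅ θquot) p vbar) (↑Sf : Set (HeightOneSpectrum (𝓞 K))),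
      Module.Finite (IwasawaAlgebra p) D.X ∧ Module.IsTorsion (IwasawaAlgebra p) D.X ∧ muInvariant p D.X = 0) :
    lambdaInvariant p DSsub.X + lambdaInvariant p DSquot.X ≤
      lambdaInvariant p (AcSelmer.XAc (W.baseChange K) p κ vbar (↑Sf : Set (HeightOneSpectrum (𝓞 K))) γ) +
        (if ∀ σ : absoluteGaloisGroup K, θquot σ = 1 then 1 else 0) := by
  have hram : ∃ τ ∈ decomp vbar, unitChar θsub τ ≠ 1 := by
    obtain ⟨τ, hτ, hne1⟩ := hramI
    exact ⟨τ, GreenbergSelmer.inertia_le_decomp vbar hτ, hne1⟩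
  -- the ∃-package of inputs at the split datum
  obtain ⟨c, τ, Φ, j₁, j₃, hj₁, hj₃, hτ, hdist, hreps₁, hreps₂, hreps₃, hj₁inj, hj₃inj, hr₁, hr₃, hr₂, hd₂, hUi, hU₁, hU₂,
    hU₃, hsur₁, hsur₂, hsur₃, hprim₁, hprim₂, hprim₃, hfin₁, hfin₂, hfin₃, hinv₁, hinv₂, hinv₃, hN₂, hfinq, hε, hN₁D,
    htrivD, hfinQ, hN₃, hinvD₁, hinvD₃, hH2⟩ :=
    SplitMultIndexInputs.indexInputs_split h263 h41 h42 h5A h32 W p hp hsplitred K hK hCD2 hH hsplit htor ι v vbar hv hvbar hne κ hκ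
      γ θsub θquot hpair hram Sf hSf hfgS htorS hμS hSsub hSquot
  haveI := hfin₁; haveI := hfin₂; haveI := hfin₃; haveI := hfinq; haveI := hfinQ
  haveI hEK : (W.baseChange K).IsElliptic := inferInstanceAs (W.map (algebraMap ℚ K)).IsElliptic
  have hcN₂ : ∀ b : ↥((W.baseChange K).geomTorsion (p : ℤ)), Continuous fun σ : absoluteGaloisGroup K ↦ σ • b :=
    fun b ↦ continuous_of_injective_comp (G := absoluteGaloisGroup K) Subtype.val_injective
      ((W.baseChange K).continuous_smul_geomPoints (b : geomPoints (W.baseChange K)))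
  -- DIV ×3 and LRS: `cd_p(ker κ ⊓ D_v̄) ≤ 1` (x1-p1-w4 gen 3, `AnticyclotomicLocalCdOne`)
  have hneD : ∃ τ ∈ decomp (K := K) vbar, κ τ ≠ 1 :=
    AnticyclotomicLocalCdOne.exists_mem_decomp_apply_ne_one_of_isAnticyclotomic κ vbar hK hp.ne' hκ hvbar
  have hdiv₁ : ∀ y : subgroupH1 (κ.kerSubgroup ⊓ decomp vbar) (charModule ∅ θsub), ∃ y', p • y' = y := fun y ↦ by
    obtain ⟨y', hy'⟩ := AnticyclotomicLocalCdOne.exists_eq_nsmul_subgroupH1_inf_decomp κ vbar hneD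
      (CharResidualSelmerCount.continuous_smul_charModule θsub) (CharResidualSelmerCount.charModule_divisible θsub) y
    exact ⟨y', hy'.symm⟩
  have hdiv₂ : ∀ y : subgroupH1 (κ.kerSubgroup ⊓ decomp vbar) ↥((W.baseChange K).geomPrimaryTorsion p),
      ∃ y', p • y' = y := fun y ↦ by
    obtain ⟨y', hy'⟩ := AnticyclotomicLocalCdOne.exists_eq_nsmul_subgroupH1_inf_decomp κ vbar hneD
      ((W.baseChange K).continuous_smul_geomPrimaryTorsion p) hd₂ y
    exact ⟨y', hy'.symm⟩
  have hdiv₃ : ∀ y : subgroupH1 (κ.kerSubgroup ⊓ decomp vbar) (charModule ∅ θquot), ∃ y', p • y' = y := fun y ↦ by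
    obtain ⟨y', hy'⟩ := AnticyclotomicLocalCdOne.exists_eq_nsmul_subgroupH1_inf_decomp κ vbar hneD
      (CharResidualSelmerCount.continuous_smul_charModule θquot) (CharResidualSelmerCount.charModule_divisible θquot) y
    exact ⟨y', hy'.symm⟩
  have hpQ : ∀ Q : ↥((W.baseChange K).geomTorsion (p : ℤ)), p • Q = 0 := fun Q ↦ by
    apply Subtype.ext
    have h := (mem_geomTorsion_iff (W.baseChange K) (p : ℤ) (Q : geomPoints (W.baseChange K))).mp Q.2
    rw [AddSubmonoidClass.coe_nsmul, ← natCast_zsmul, h]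
    rfl
  have hlrs := AnticyclotomicLocalCdOne.resH1Hom_id_surjective_inf_decomp κ vbar hneD
    (fun a ↦ Φ.continuous_smul_sub hcN₂ a) hcN₂ (fun a ↦ Φ.continuous_smul_quot hcN₂ a)
    (fun n ↦ ⟨1, Φ.incl_injective (by rw [map_nsmul, map_zero, pow_one]; exact hpQ _)⟩)
    Φ.incl Φ.incl_smul Φ.incl_injective Φ.proj Φ.proj_smul Φ.proj_incl
    (fun b hb ↦ Φ.mem_range_incl_of_proj_eq_zero b hb) Φ.proj_surjective
  -- FIN: `E(K_{∞,v̄})[p^∞]` is finite at the SPLIT multiplicative `v̄` (p672062, from k5-c4's Fin_v)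
  haveI hfinED : Finite {x : ↥((W.baseChange K).geomPrimaryTorsion p) // ∀ g : ↥(κ.kerSubgroup ⊓ decomp vbar), g • x = x} :=
    SplitMultLocalHZero.finite_fixed_geomPrimaryTorsion_inf_decomp_of_split W K vbar κ hp.ne' hsplitred hK hsplit hvbar hκ
  -- the MID-LEVEL identity (LEAD x1-p1 g4's composition, fed the package)
  have hmid := ResidualIndexAssembly.zpCorank_datumStrictSelmer_add_eq κ.kerSubgroup p
    (↑Sf : Set (HeightOneSpectrum (𝓞 K))) vbar hvbar Φ.incl Φ.proj Φ.incl_smul Φ.proj_smul Φ.incl_injective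
    Φ.proj_surjective (fun b hb ↦ Φ.mem_range_incl_of_proj_eq_zero b hb) Φ.proj_incl j₁
    (AddSubgroup.inclusion (geomTorsion_le_geomPrimaryTorsion (W.baseChange K) p)) j₃ hj₁ (fun _ _ ↦ rfl) hj₃ hj₁inj
    (AddSubgroup.inclusion_injective _) hj₃inj hr₁ hr₂ hr₃ (CharResidualSelmerCount.charModule_divisible θsub) hd₂
    (CharResidualSelmerCount.charModule_divisible θquot) (fun a ↦ Φ.continuous_smul_sub hcN₂ a) hcN₂
    (fun a ↦ Φ.continuous_smul_quot hcN₂ a) (CharResidualSelmerCount.continuous_smul_charModule θsub)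
    ((W.baseChange K).continuous_smul_geomPrimaryTorsion p) (CharResidualSelmerCount.continuous_smul_charModule θquot)
    hUi hU₁ hU₂ hU₃ c τ hreps₁ hreps₂ hreps₃ hsur₁ hsur₂ hsur₃ hdiv₁ hdiv₂ hdiv₃ hlrs hprim₁ hprim₂ hprim₃ hinv₁ hinv₂ hinv₃
    hN₂ hε hN₁D htrivD hN₃ hinvD₁ hinvD₃ hH2
  haveI := hfgS
  exact SplitMultIndexPlumbing.lambdaInvariant_add_le_of_mid_split W p hp hsplitred K hK hsplit vbar hvbar κ hκ γ θsub θquot hpair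
    hramI Sf hSf DSsub DSquot c τ hreps₃ hmid htorS hμS hSsub hSquot

end Summit.BirchSwinnertonDyer.BirchSwinnertonDyer.Theorems.SplitMultLambdaLE

end
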